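import Mathlib
import HarnessLib
import Literature.NumberTheory.Automorphic.StrongArtinCentralCharacter

/-!
# Stub `stub_archParameter` — crux `QuarterDeficit1951.CorrespondentFingerprint`, line `Sketch`

For `π = W / W'` on `GL₂(𝔸_ℚ)` with `π = π(τ)` almost everywhere (`IsPiOfArtinRep τ π`, `τ` a
complex Artin representation) and `π` L-algebraic, the archimedean Harish-Chandra parameter of `π`
is `{a, -a}` for an integer `a`: `IsLAlgebraic` gives an integral parameter `{k, l}` at the unique
embedding `ℚ →+* ℂ`, and the centre gives `k + l = 0`
(`IsPiOfArtinRep.add_eq_zero_of_hasArchParameter`).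
-/

set_option linter.dupNamespace false

noncomputable section

-- `Classical`: the place subtypes indexing `mixedSpace ℚ` are `Fintype` classically
-- (`NormedCommRing (mixedSpace ℚ)`, needed by `AutomorphyDatum.gl`).
open scoped NumberField Classical
open Literature.NumberTheory.Automorphic Literature.NumberTheory.GaloisRepresentations

namespace Summit.Langlands.Langlands.Theorems.CorrespondentFingerprint

/-- An L-algebraic infinity type `T` for `GL₂/ℚ` which is well formed has, at every embedding, the
multiset of `z`-exponents `{k, l}` for two integers `k, l` not depending on the embedding
(`ℚ →+* ℂ` is a subsingleton, `Rat.subsingleton_ringHom`). [cite: BuzzardGeeLMS2014, §3.1] -/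
theorem exists_int_archParameter_eq_of_isLAlgebraic {T : InfinityType ℚ 2}
    (hwf : T.IsWellFormed) (hL : T.IsLAlgebraic) :
    ∃ k l : ℤ, (fun σ : ℚ →+* ℂ => (T σ).map ArchWeight.a) =
      fun _ => ({(k : ℂ), (l : ℂ)} : Multiset ℂ) := by
  set σ₀ : ℚ →+* ℂ := Rat.castHom ℂ
  obtain ⟨p, q, hpq⟩ := Multiset.card_eq_two.1 (hwf.1 σ₀)
  obtain ⟨k, -, hk, -⟩ := hL σ₀ p (by rw [hpq]; simp)
  obtain ⟨l, -, hl, -⟩ := hL σ₀ q (by rw [hpq]; simp)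
  refine ⟨k, l, funext fun σ => ?_⟩
  rw [Subsingleton.elim σ σ₀, hpq]
  simp [hk, hl]

/-- **STUB `stub_archParameter`**: for `π = W / W'` on `GL₂(𝔸_ℚ)` with `π = π(τ)` almost everywhere
(`IsPiOfArtinRep τ π`, `τ` a complex Artin representation) and `π` L-algebraic, the archimedean
Harish-Chandra parameter of `π` is `{a, -a}` for an integer `a` (`IsLAlgebraic` gives an integral
parameter `{k, l}`; the centre gives `k + l = 0`, `IsPiOfArtinRep.add_eq_zero_of_hasArchParameter`).
[cite: BuzzardGeeLMS2014, §3.1] [cite: Gelbart1997, Prop. 4.2 (proof)] -/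
theorem stub_archParameter : ∀ (hcpt : isCompact_glFiniteIntegralLevel 2 ℚ)
    (π : AutomorphicRepData (AutomorphyDatum.gl 2 ℚ hcpt)) (τ : FramedArtinRep ℚ 2),
    IsPiOfArtinRep τ π → π.IsLAlgebraic →
    ∃ a : ℤ, π.HasArchParameter (fun _ => ({(a : ℂ), -(a : ℂ)} : Multiset ℂ)) := by
  intro hcpt π τ hτ hLalg
  obtain ⟨T, ⟨hwf, harch⟩, hL⟩ := hLalg
  obtain ⟨k, l, hkl⟩ := exists_int_archParameter_eq_of_isLAlgebraic hwf hL
  rw [hkl] at harch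
  have hsum : (k : ℂ) + (l : ℂ) = 0 := hτ.add_eq_zero_of_hasArchParameter harch
  refine ⟨k, ?_⟩
  have hl : (l : ℂ) = -(k : ℂ) := by linear_combination hsum
  rw [← hl]
  exact harch

end Summit.Langlands.Langlands.Theorems.CorrespondentFingerprint

end
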